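import Summits.QuantumFields.YangMills.Theorems.NPointIsotropy.Negative.ModelBlindFalse
import Summits.QuantumFields.YangMills.Cruxes.NPointIsotropy.SketchIdeator3

/-!
# Crux triage r1 / triager 3 (gen 2), stmt-QuantumFields-11686 (`PencilRigidity.NPointIsotropy`):
# the first lemma `QuarterTurnPositive` of card `quarter-turn-root` is false as typed

Target: the EXACT declaration
`Summit.QuantumFields.YangMills.Cruxes.NPointIsotropy.Sketch.QuarterTurnPositive` of
`Summits/QuantumFields/YangMills/Cruxes/NPointIsotropy/SketchIdeator3.lean` (ideator 3, round 1; imported,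
not copied), with its auxiliaries `Sketch.EightFrameRP`, `Sketch.IsQuarterTurn`, `Sketch.IsQuadrantSupported`.
It asserts: E3 + translations + RP in the eight planar frames make the hypercubic quarter-turn
`R_q : e₀ ↦ -e₁, e₁ ↦ e₀` a POSITIVE HERMITIAN operator on the vectors of ALL `e₀`-time-ordered test
functions supported in the quadrant `{x₀ > 0, x₁ > 0}`:
`Σ conj cᵢ cⱼ 𝔖(θ(R_q Fᵢ)* ⊗ Fⱼ) ≥ 0`.

Main result: `not_QuarterTurnPositive : ¬ Sketch.QuarterTurnPositive`.

WHY IT IS FALSE. `θ₀ ∘ R_q` is the anti-diagonal mirror `Θ' : (x₀,x₁) ↦ (-x₁,-x₀)` (`x₀ + x₁ = 0`), and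
reflection positivity across it only constrains test functions that are time-ORDERED in the anti-diagonal
frame, i.e. with `x₀ + x₁` strictly increasing along the points; `e₀`-ordering plus quadrant support does
not give that, and E3 cannot re-sort configurations on the codimension-1 set where two points have EQUAL
anti-diagonal time — where the typed OS clauses leave singular parts of `𝔖ₙ` completely free. Witness:
the one-species family `𝔖₆ = -T`, `𝔖ₙ = 0 (n ≠ 6)`, where `T` is the `W(B₄) × S₆`-symmetrised integral
over the diagonal translates of ONE planar six-point configuration
`Z = ((-10,-60), (-10,-50), (-50,-10), (10,20), (30,20), (40,30))` (coordinates `(x₀,x₁)`, `x₂ = x₃ = 0`),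
chosen so that for EACH of the four planar mirror directions `e₀, e₁, e₀+e₁, e₀-e₁` two of its points have
equal component (`exists_pair_Z`). Consequently `T` vanishes on every `θF* ⊗ G` with `F, G` time-ordered in
any of the eight frames (`S6_frame_rp`: the family is reflection positive in all eight frames, with
identically vanishing OS forms), it is symmetric, translation invariant and even fully hypercubic
invariant (`T_hyper`) — yet for the `e₀`-time-ordered, quadrant-supported three-point test function
`F₃` = (bumps at `Y = ((10,50),(50,10),(60,10))`) + (bumps at `X = ((10,20),(30,20),(40,30))`) the
quarter-turn form is `𝔖₆(θ(R_q F₃)* ⊗ F₃) = -T(θ(R_q F₃)* ⊗ F₃)` with `Re T(…) > 0`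
(`Z = (Θ'Y reversed, X)` is charged by the identity term; all terms are `≥ 0`). The pair
`(10,50), (50,10)` of `Y` has equal anti-diagonal time `x₀ + x₁ = 60`: exactly the unsortable boundary.

MORAL for the line (shared with card `quarter-turn-corner-operator`, whose first lemma
`QuarterTurnPositiveSymmetric` carries the missing hypothesis `IsTimeOrdered (linActMulti Rq G)` and is
provable now): REPAIRED first lemma = add `∀ j, IsTimeOrdered (linActMulti Rq (F j))` (equivalently
`StrictMono (x₀ + x₁)` on `tsupport (F j)`); the positive quarter-turn `Q` is then densely defined on the
span of anti-diagonally orderable quadrant vectors, which is all the line needs. The lever survives; the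
filed statement does not.
-/

noncomputable section

-- Mathlib's `SimplexCategory` instance `Fintype (Fin (x.len + 1))` matches `Fintype (Fin 4)` (tree-known
-- workaround, as in the Negative files).
attribute [-instance] SimplexCategory.instFintypeToTypeOrderHomFinHAddNatLenOfNat

namespace Summit.QuantumFields.YangMills.Cruxes.NPointIsotropy.Triage3g2

open scoped BigOperators ComplexConjugate InnerProductSpace
open MeasureTheory Filter Topology
open Literature.MathematicalPhysics.QuantumLattice Literature.MathematicalPhysics.AQFT
  Literature.MathematicalPhysics.QuantumFieldTheory
open Summit.QuantumFields.YangMills.Theorems.NPointIsotropy.Negative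
open Summit.QuantumFields.YangMills.Cruxes.NPointIsotropy.Sketch
  (EightFrameRP IsQuarterTurn IsQuadrantSupported QuarterTurnPositive)

/-! ## §1 Planar points and the six-point configuration `Z` -/

/-- The point `(a, b, 0, 0)` of the `(x₀,x₁)`-plane. -/
def pt (a b : ℝ) : E4 := a • e 0 + b • e 1

/-- Coordinates of a planar point. -/
@[simp] theorem pt_apply (a b : ℝ) (k : Fin 4) :
    pt a b k = if k = 0 then a else if k = 1 then b else 0 := by
  fin_cases k <;> simp [pt, e]

/-- Pairing a planar point with a vector. -/
theorem inner_pt (a b : ℝ) (m : E4) : ⟪pt a b, m⟫_ℝ = a * m 0 + b * m 1 := by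
  simp [pt, e, inner_add_left, real_inner_smul_left, EuclideanSpace.inner_single_left]

/-- **The six-point planar configuration** carrying the junk: `(Θ' Y reversed, X)` for the two bump
triples `Y`, `X` of §4 (`Θ' (a, b) = (-b, -a)` the anti-diagonal mirror). -/
def Z : Fin 6 → E4 := ![pt (-10) (-60), pt (-10) (-50), pt (-50) (-10), pt 10 20, pt 30 20, pt 40 30]

theorem Z0 : Z 0 = pt (-10) (-60) := rfl
theorem Z1 : Z 1 = pt (-10) (-50) := rfl
theorem Z2 : Z 2 = pt (-50) (-10) := rfl
theorem Z3 : Z 3 = pt 10 20 := rfl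
theorem Z4 : Z 4 = pt 30 20 := rfl
theorem Z5 : Z 5 = pt 40 30 := rfl

/-- **Key combinatorics.** For every `m` whose planar part is an axis or a diagonal direction
(`m 0 = 0 ∨ m 1 = 0 ∨ (m 0)² = (m 1)²`), two points of `Z` have the same pairing with `m`: equal `x₀`
(points 0, 1), equal `x₁` (points 3, 4), equal `x₀ + x₁` (points 1, 2), equal `x₀ - x₁` (points 4, 5). -/
theorem exists_pair_Z (m : E4) (hm : m 0 = 0 ∨ m 1 = 0 ∨ m 0 ^ 2 = m 1 ^ 2) :
    ∃ p q : Fin 6, p ≠ q ∧ ⟪Z p, m⟫_ℝ = ⟪Z q, m⟫_ℝ := by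
  rcases hm with h | h | h
  · exact ⟨3, 4, by decide, by rw [Z3, Z4, inner_pt, inner_pt, h]; ring⟩
  · exact ⟨0, 1, by decide, by rw [Z0, Z1, inner_pt, inner_pt, h]; ring⟩
  · rcases sq_eq_sq_iff_eq_or_eq_neg.1 h with h' | h'
    · exact ⟨1, 2, by decide, by rw [Z1, Z2, inner_pt, inner_pt, h']; ring⟩
    · exact ⟨4, 5, by decide, by rw [Z4, Z5, inner_pt, inner_pt, h']; ring⟩

/-- The `W(B₄)`-preimage of a frame vector `a e₀ + b e₁` with `a = 0 ∨ b = 0 ∨ a² = b²` (the eight planar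
frames, and more) satisfies the hypothesis of `exists_pair_Z`. -/
theorem sp_symm_frame (σ : Equiv.Perm (Fin 4)) (ε : Fin 4 → Bool) (a b : ℝ)
    (hab : a = 0 ∨ b = 0 ∨ a ^ 2 = b ^ 2) :
    let m := (sp σ ε).symm (a • EuclideanSpace.single 0 1 + b • EuclideanSpace.single 1 1)
    m 0 = 0 ∨ m 1 = 0 ∨ m 0 ^ 2 = m 1 ^ 2 := by
  intro m
  have hinj := σ.injective
  by_cases h00 : σ 0 = 0
  · -- then σ 1 ≠ 0
    have h10 : σ 1 ≠ 0 := fun h => absurd (hinj (h.trans h00.symm)) (by decide)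
    by_cases h11 : σ 1 = 1
    · have hm0 : m 0 = sgn (ε 0) * a := by simp [m, sp_symm_apply, h00, mul_comm]
      have hm1 : m 1 = sgn (ε 1) * b := by simp [m, sp_symm_apply, h11, mul_comm]
      rcases hab with ha | hb | hsq
      · left; rw [hm0, ha, mul_zero]
      · right; left; rw [hm1, hb, mul_zero]
      · right; right
        rw [hm0, hm1, mul_pow, mul_pow, sq (sgn _), sgn_mul_self, sq (sgn _), sgn_mul_self, hsq]
    · right; left
      simp [m, sp_symm_apply, h10, h11]
  · by_cases h01 : σ 0 = 1
    · have h11 : σ 1 ≠ 1 := fun h => absurd (hinj (h.trans h01.symm)) (by decide)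
      by_cases h10 : σ 1 = 0
      · have hm0 : m 0 = sgn (ε 0) * b := by simp [m, sp_symm_apply, h01, mul_comm]
        have hm1 : m 1 = sgn (ε 1) * a := by simp [m, sp_symm_apply, h10, mul_comm]
        rcases hab with ha | hb | hsq
        · right; left; rw [hm1, ha, mul_zero]
        · left; rw [hm0, hb, mul_zero]
        · right; right
          rw [hm0, hm1, mul_pow, mul_pow, sq (sgn _), sgn_mul_self, sq (sgn _), sgn_mul_self, hsq]
      · right; left
        simp [m, sp_symm_apply, h10, h11]
    · left
      simp [m, sp_symm_apply, h00, h01]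

/-- Frame form: for `R e₀ = a e₀ + b e₁` with `a = 0 ∨ b = 0 ∨ a² = b²`. -/
theorem frame_hw (R : E4 ≃ₗᵢ[ℝ] E4) (a b : ℝ) (hab : a = 0 ∨ b = 0 ∨ a ^ 2 = b ^ 2)
    (hR : R (EuclideanSpace.single 0 1) = a • EuclideanSpace.single 0 1 + b • EuclideanSpace.single 1 1) :
    ∀ (σ : Equiv.Perm (Fin 4)) (ε : Fin 4 → Bool),
      ((sp σ ε).symm (R (EuclideanSpace.single 0 1))) 0 = 0 ∨
      ((sp σ ε).symm (R (EuclideanSpace.single 0 1))) 1 = 0 ∨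
      ((sp σ ε).symm (R (EuclideanSpace.single 0 1))) 0 ^ 2 =
        ((sp σ ε).symm (R (EuclideanSpace.single 0 1))) 1 ^ 2 := by
  intro σ ε
  rw [hR]
  exact sp_symm_frame σ ε a b hab

/-! ## §2 The junk six-point functional `T` and the family `𝔖₆ = -T` -/

/-- Diagonal embedding `a ↦ (a, …, a)`. -/
def diagE : E4 →L[ℝ] (Fin 6 → E4) := ContinuousLinearMap.pi fun _ => ContinuousLinearMap.id ℝ E4

/-- Coordinates of the diagonal embedding. -/
@[simp] theorem diagE_apply (a : E4) (i : Fin 6) : diagE a i = a := rfl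

/-- The diagonal translates of `Z`: `a ↦ Z + (a, …, a)`. -/
def gZ (a : E4) : Fin 6 → E4 := fun i => Z i + a

/-- Unfolding `gZ`. -/
@[simp] theorem gZ_apply (a : E4) (i : Fin 6) : gZ a i = Z i + a := rfl

/-- `gZ` has temperate growth (constant plus linear). -/
theorem gZ_hasTemperateGrowth : Function.HasTemperateGrowth gZ := by
  have h := (Function.HasTemperateGrowth.const (E := E4) (Z : Fin 6 → E4)).add diagE.hasTemperateGrowth
  have hg : gZ = (fun _ : E4 => Z) + ⇑diagE := by
    funext a; funext i; rfl
  rw [hg]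
  exact h

/-- The lower bound `‖a‖ ≤ (1 + ‖Z 0‖)(1 + ‖gZ a‖)` required by `SchwartzMap.compCLM`. -/
theorem gZ_upper : ∃ (k : ℕ) (C : ℝ), ∀ a : E4, ‖a‖ ≤ C * (1 + ‖gZ a‖) ^ k := by
  refine ⟨1, 1 + ‖Z 0‖, fun a => ?_⟩
  have h1 : ‖Z 0 + a‖ ≤ ‖gZ a‖ := norm_le_pi_norm (gZ a) 0
  have h2 : ‖a‖ ≤ ‖Z 0 + a‖ + ‖Z 0‖ := by
    calc ‖a‖ = ‖(Z 0 + a) - Z 0‖ := by rw [add_sub_cancel_left]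
      _ ≤ ‖Z 0 + a‖ + ‖Z 0‖ := norm_sub_le _ _
  rw [pow_one]
  nlinarith [norm_nonneg (Z 0), norm_nonneg (gZ a), norm_nonneg a]

/-- `λ₆ G = ∫_{ℝ⁴} G (Z + (a,…,a)) da` as a continuous linear functional. -/
def lam6 : SchwartzMap (Fin 6 → E4) ℂ →L[ℂ] ℂ :=
  (SchwartzMap.integralCLM ℂ (volume : Measure E4)).comp
    (SchwartzMap.compCLM ℂ (g := gZ) gZ_hasTemperateGrowth gZ_upper)

/-- Unfolding `λ₆`. -/
theorem lam6_apply (G : SchwartzMap (Fin 6 → E4) ℂ) : lam6 G = ∫ a : E4, G (fun i => Z i + a) := by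
  simp only [lam6, ContinuousLinearMap.comp_apply, SchwartzMap.integralCLM_apply]
  congr 1

/-- **The junk six-point functional**: the `W(B₄) × S₆`-symmetrisation of `λ₆`. -/
def T : SchwartzMap (Fin 6 → E4) ℂ →L[ℂ] ℂ :=
  ∑ g : WIdx, ∑ π : Equiv.Perm (Fin 6), (lam6.comp (permTest π)).comp (linActMulti (sp g.1 g.2).symm)

set_option maxRecDepth 20000 in
/-- Unfolding `T` as a double sum of integrals over `ℝ⁴`. (The raised recursion depth only serves the
`sum_apply` step over the index type `W(B₄) × S₆`.) -/
theorem T_apply (G : SchwartzMap (Fin 6 → E4) ℂ) :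
    T G = ∑ g : WIdx, ∑ π : Equiv.Perm (Fin 6), ∫ a : E4, G (fun i => sp g.1 g.2 (Z (π i) + a)) := by
  simp only [T, _root_.sum_apply, ContinuousLinearMap.comp_apply,
    lam6_apply, permTest_apply, linActMulti_apply, LinearIsometryEquiv.symm_symm]
  rfl

/-- **Core vanishing lemma.** If every `W(B₄)`-preimage `m` of `w` has `m 0 = 0 ∨ m 1 = 0 ∨ m 0² = m 1²`,
then `T` kills every test function vanishing at configurations two of whose points pair equally with `w`. -/
theorem T_eq_zero_of_vanish (H : SchwartzMap (Fin 6 → E4) ℂ) (w : E4)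
    (hw : ∀ (σ : Equiv.Perm (Fin 4)) (ε : Fin 4 → Bool),
      ((sp σ ε).symm w) 0 = 0 ∨ ((sp σ ε).symm w) 1 = 0 ∨ ((sp σ ε).symm w) 0 ^ 2 = ((sp σ ε).symm w) 1 ^ 2)
    (hH : ∀ z : Fin 6 → E4, (∃ p q : Fin 6, p ≠ q ∧ ⟪z p, w⟫_ℝ = ⟪z q, w⟫_ℝ) → H z = 0) :
    T H = 0 := by
  rw [T_apply]
  refine Finset.sum_eq_zero fun g _ => Finset.sum_eq_zero fun π _ => ?_
  have hz : (fun a : E4 => H (fun i => sp g.1 g.2 (Z (π i) + a))) = fun _ => 0 := by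
    funext a
    apply hH
    obtain ⟨p, q, hpq, hinner⟩ := exists_pair_Z ((sp g.1 g.2).symm w) (hw g.1 g.2)
    refine ⟨π.symm p, π.symm q, fun h => hpq (π.symm.injective h), ?_⟩
    simp only [Equiv.apply_symm_apply]
    rw [← LinearIsometryEquiv.inner_map_map (sp g.1 g.2) (Z p),
      ← LinearIsometryEquiv.inner_map_map (sp g.1 g.2) (Z q),
      LinearIsometryEquiv.apply_symm_apply] at hinner
    rw [map_add, map_add, inner_add_left, inner_add_left, hinner]
  rw [hz]
  simp

/-- `T` is symmetric under permutations of the six arguments (re-indexing of the `S₆`-sum). -/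
theorem T_permTest (π₀ : Equiv.Perm (Fin 6)) (G : SchwartzMap (Fin 6 → E4) ℂ) :
    T (permTest π₀ G) = T G := by
  rw [T_apply, T_apply]
  refine Finset.sum_congr rfl fun g _ => ?_
  simp only [permTest_apply]
  exact Fintype.sum_equiv (Equiv.mulRight π₀) _ _ fun π => rfl

/-- `T` is invariant under diagonal translations (translation invariance of Lebesgue measure on `ℝ⁴`). -/
theorem T_translate (v : E4) (G : SchwartzMap (Fin 6 → E4) ℂ) :
    T (translateMulti v G) = T G := by
  rw [T_apply, T_apply]
  refine Finset.sum_congr rfl fun g _ => Finset.sum_congr rfl fun π _ => ?_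
  simp only [translateMulti_apply]
  have key : ∀ a : E4, (fun i => sp g.1 g.2 (Z (π i) + a) - v) =
      fun i => sp g.1 g.2 (Z (π i) + (a - (sp g.1 g.2).symm v)) := by
    intro a
    funext i
    rw [map_add, map_add, map_sub, LinearIsometryEquiv.apply_symm_apply]
    abel
  simp_rw [key]
  exact integral_sub_right_eq_self (μ := (volume : Measure E4))
    (fun a => G fun i => sp g.1 g.2 (Z (π i) + a)) _

/-- `T` is invariant under pull-back by any signed permutation (re-indexing of the `W(B₄)`-sum). -/
theorem T_sp (τ : Equiv.Perm (Fin 4)) (δ : Fin 4 → Bool) (G : SchwartzMap (Fin 6 → E4) ℂ) :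
    T (linActMulti (sp τ δ).symm G) = T G := by
  rw [T_apply, T_apply]
  simp only [linActMulti_apply, LinearIsometryEquiv.symm_symm, sp_comp_apply]
  exact Fintype.sum_equiv (shear τ δ) _ _ fun g => rfl

/-- `T` is invariant under pull-back by every isometry permuting the axes up to sign (full hypercubic
invariance of the witness; not needed for the refutation, recorded for the moral). -/
theorem T_hyper {R : E4 ≃ₗᵢ[ℝ] E4} (hR : IsHyper R) (G : SchwartzMap (Fin 6 → E4) ℂ) :
    T (linActMulti R G) = T G := by
  obtain ⟨τ, δ, hτ⟩ := exists_sp_of_isHyper hR.symm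
  have : linActMulti R G = linActMulti (sp τ δ).symm G := by
    ext x
    simp only [linActMulti_apply, LinearIsometryEquiv.symm_symm, hτ]
  rw [this, T_sp]

/-- **The witness family**: `𝔖₆ = -T`, all other `𝔖ₙ = 0`. -/
def S6 : SchwingerFamily E4
  | 6 => -T
  | _ => 0

/-- Degree six of the witness family. -/
theorem S6_six : S6 6 = -T := rfl

/-- All degrees other than `6` vanish. -/
theorem S6_of_ne {N : ℕ} (h6 : N ≠ 6) : S6 N = 0 := by
  rcases N with _ | _ | _ | _ | _ | _ | _ | N
  · rfl
  · rfl
  · rfl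
  · rfl
  · rfl
  · rfl
  · exact absurd rfl h6
  · rfl

/-- Negation of a functional, pointwise (generic `rfl`, so that no witness is ever unfolded). -/
theorem neg_clm_apply {n : ℕ} (L : SchwartzMap (Fin n → E4) ℂ →L[ℂ] ℂ) (G : SchwartzMap (Fin n → E4) ℂ) :
    (-L) G = -(L G) := rfl

/-- The whole family kills what `T` kills. -/
theorem S6_eq_zero_of_vanish {N : ℕ} (H : SchwartzMap (Fin N → E4) ℂ) (w : E4)
    (hw : ∀ (σ : Equiv.Perm (Fin 4)) (ε : Fin 4 → Bool),
      ((sp σ ε).symm w) 0 = 0 ∨ ((sp σ ε).symm w) 1 = 0 ∨ ((sp σ ε).symm w) 0 ^ 2 = ((sp σ ε).symm w) 1 ^ 2)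
    (hH : ∀ z : Fin N → E4, (∃ p q : Fin N, p ≠ q ∧ ⟪z p, w⟫_ℝ = ⟪z q, w⟫_ℝ) → H z = 0) :
    S6 N H = 0 := by
  by_cases hN : N = 6
  · subst hN
    rw [S6_six, neg_clm_apply, neg_eq_zero]
    exact T_eq_zero_of_vanish H w hw hH
  · rw [S6_of_ne hN]
    rfl

/-- E3 for the witness family, degreewise and on all test functions. -/
theorem S6_permTest (n : ℕ) (π : Equiv.Perm (Fin n)) (F : SchwartzMap (Fin n → E4) ℂ) :
    S6 n (permTest π F) = S6 n F := by
  by_cases hn : n = 6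
  · subst hn
    rw [S6_six, neg_clm_apply, neg_clm_apply, T_permTest]
  · rw [S6_of_ne hn]
    rfl

/-- Translation invariance of the witness family (all degrees, all test functions). -/
theorem S6_translate (n : ℕ) (a : E4) (F : SchwartzMap (Fin n → E4) ℂ) :
    S6 n (translateMulti a F) = S6 n F := by
  by_cases hn : n = 6
  · subst hn
    rw [S6_six, neg_clm_apply, neg_clm_apply, T_translate]
  · rw [S6_of_ne hn]
    rfl

/-- Full hypercubic invariance of the witness family (all degrees, all test functions). -/
theorem S6_hyper (n : ℕ) {R : E4 ≃ₗᵢ[ℝ] E4} (hR : IsHyper R) (F : SchwartzMap (Fin n → E4) ℂ) :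
    S6 n (linActMulti R F) = S6 n F := by
  by_cases hn : n = 6
  · subst hn
    rw [S6_six, neg_clm_apply, neg_clm_apply, T_hyper hR]
  · rw [S6_of_ne hn]
    rfl

/-- **Reflection positivity in pull-back form for EVERY frame `R e₀ = a e₀ + b e₁` with
`a = 0 ∨ b = 0 ∨ a² = b²`** (in particular the eight frames of the crux): every OS matrix entry vanishes,
because `θF* ⊗ G` with `F, G` time-ordered in the frame lives on configurations with pairwise distinct
`R e₀`-components, while the support of `T` has an equal pair in every such direction. -/
theorem S6_frame_rp (R : E4 ≃ₗᵢ[ℝ] E4) (a b : ℝ) (hab : a = 0 ∨ b = 0 ∨ a ^ 2 = b ^ 2)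
    (hR : R (EuclideanSpace.single 0 1) = a • EuclideanSpace.single 0 1 + b • EuclideanSpace.single 1 1) :
    (SchwingerFamily.toLabelled (fun n => (S6 n).comp (linActMulti R))).IsReflectionPositive := by
  intro N deg lab F hF H hH
  have hterm : ∀ i j, (SchwingerFamily.toLabelled fun n => (S6 n).comp (linActMulti R))
      (deg i + deg j) (Fin.append (lab i ∘ Fin.rev) (lab j)) (H i j) = 0 := by
    intro i j
    simp only [SchwingerFamily.toLabelled_apply, ContinuousLinearMap.comp_apply]
    refine S6_eq_zero_of_vanish _ (R (EuclideanSpace.single 0 1)) (frame_hw R a b hab hR) ?_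
    intro z hz
    rw [linActMulti_apply]
    apply append_apply_eq_zero (timeSep_of_isTimeOrdered (hF i)) (timeSep_of_isTimeOrdered (hF j)) (hH i j)
    obtain ⟨p, q, hpq, h⟩ := hz
    exact ⟨p, q, hpq, by rw [symm_apply_zero, symm_apply_zero, h]⟩
  simp only [hterm, Finset.sum_const_zero, Complex.zero_re, Complex.zero_im, le_refl, and_self]

/-- The eight-frame RP hypothesis of the crux (Sketch form) for the witness family. -/
theorem S6_eightFrameRP : EightFrameRP S6 := fun R a b _ hab hR => S6_frame_rp R a b hab hR

/-! ## §3 The quarter-turn and the anti-diagonal mirror -/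

/-- The hypercubic quarter-turn `R_q : e₀ ↦ -e₁, e₁ ↦ e₀` (fixing `e₂, e₃`), as a signed permutation. -/
def Rq : E4 ≃ₗᵢ[ℝ] E4 := sp (Equiv.swap 0 1) fun i => decide (i = 0)

@[simp] theorem Rq_symm_apply0 (x : E4) : Rq.symm x 0 = -x 1 := by
  simp [Rq, sp_symm_apply, sgn]
@[simp] theorem Rq_symm_apply1 (x : E4) : Rq.symm x 1 = x 0 := by
  simp [Rq, sp_symm_apply, sgn, Equiv.swap_apply_def]
@[simp] theorem Rq_symm_apply2 (x : E4) : Rq.symm x 2 = x 2 := by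
  simp [Rq, sp_symm_apply, sgn, Equiv.swap_apply_def]
@[simp] theorem Rq_symm_apply3 (x : E4) : Rq.symm x 3 = x 3 := by
  simp [Rq, sp_symm_apply, sgn, Equiv.swap_apply_def]

/-- `R_q` is a quarter-turn in the sense of the card. -/
theorem isQuarterTurn_Rq : IsQuarterTurn Rq := by
  refine ⟨?_, ?_, ?_, ?_⟩ <;> ext k <;> fin_cases k <;> simp [Rq, sp_apply, sgn, Equiv.swap_apply_def]

/-- `R_q⁻¹ ∘ θ₀` is the anti-diagonal mirror `Θ' : (a, b) ↦ (-b, -a)` on the plane. -/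
theorem Rq_symm_theta_pt (a b : ℝ) : Rq.symm (timeReflection 4 (pt a b)) = pt (-b) (-a) := by
  ext k
  fin_cases k <;> simp [timeReflection_apply]

/-! ## §4 The test function `F₃`: two bump triples in the quadrant -/

/-- Centres of the first triple `Y` (its first two points have EQUAL anti-diagonal time `x₀ + x₁ = 60`). -/
def cY : Fin 3 → E4 := ![pt 10 50, pt 50 10, pt 60 10]

/-- Centres of the second triple `X`. -/
def cX : Fin 3 → E4 := ![pt 10 20, pt 30 20, pt 40 30]

/-- Product of unit-radius bumps at the centres `c`. -/
def blob (c : Fin 3 → E4) (u : Fin 3 → E4) : ℝ := ∏ i, (bump (c i)) (u i)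

/-- Blobs are non-negative. -/
theorem blob_nonneg (c u : Fin 3 → E4) : 0 ≤ blob c u := Finset.prod_nonneg fun i _ => (bump (c i)).nonneg

/-- Blobs are smooth. -/
theorem blob_contDiff (c : Fin 3 → E4) : ContDiff ℝ (⊤ : ℕ∞) (blob c) :=
  contDiff_prod fun i _ => (bump (c i)).contDiff.comp ((ContinuousLinearMap.proj i : (Fin 3 → E4) →L[ℝ] E4).contDiff)

/-- Where a blob is non-zero, every point lies in the unit ball about its centre. -/
theorem blob_ball {c u : Fin 3 → E4} (h : blob c u ≠ 0) (i : Fin 3) : u i ∈ Metric.ball (c i) 1 := by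
  have h' := (Finset.prod_ne_zero_iff.1 h) i (Finset.mem_univ _)
  have : u i ∈ Function.support (bump (c i)) := h'
  rwa [(bump (c i)).support_eq] at this

/-- A blob takes the value `1` at its centres. -/
theorem blob_self (c : Fin 3 → E4) : blob c c = 1 :=
  Finset.prod_eq_one fun i _ => (bump (c i)).one_of_mem_closedBall (by simp [bump])

/-- The closed box of radius `1` about the centres. -/
def box (c : Fin 3 → E4) : Set (Fin 3 → E4) := Set.pi Set.univ fun i => Metric.closedBall (c i) 1

theorem isCompact_box (c : Fin 3 → E4) : IsCompact (box c) :=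
  isCompact_univ_pi fun i => isCompact_closedBall (c i) 1

theorem isClosed_box (c : Fin 3 → E4) : IsClosed (box c) := isClosed_set_pi fun _ _ => Metric.isClosed_closedBall

theorem blob_box {c u : Fin 3 → E4} (h : blob c u ≠ 0) : u ∈ box c :=
  fun i _ => Metric.ball_subset_closedBall (blob_ball h i)

/-- Coordinates of a point of a closed unit ball are within `1` of the centre's. -/
theorem coord_of_mem_closedBall {v c : E4} (h : v ∈ Metric.closedBall c 1) (k : Fin 4) :
    c k - 1 ≤ v k ∧ v k ≤ c k + 1 := by
  have h1 : |(v - c) k| ≤ ‖v - c‖ := by simpa [Real.norm_eq_abs] using PiLp.norm_apply_le (v - c) k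
  have h2 : ‖v - c‖ ≤ 1 := by simpa [dist_eq_norm] using h
  rw [PiLp.sub_apply] at h1
  obtain ⟨h3, h4⟩ := abs_le.1 (h1.trans h2)
  constructor <;> linarith

/-- `f₃ = blob_Y + blob_X`. -/
def f3 (u : Fin 3 → E4) : ℝ := blob cY u + blob cX u

theorem f3_nonneg (u : Fin 3 → E4) : 0 ≤ f3 u := add_nonneg (blob_nonneg _ _) (blob_nonneg _ _)

theorem f3_ne_zero {u : Fin 3 → E4} (h : f3 u ≠ 0) : blob cY u ≠ 0 ∨ blob cX u ≠ 0 := by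
  by_contra h'
  simp only [not_or, not_not] at h'
  exact h (by rw [f3, h'.1, h'.2, add_zero])

/-- `f₃ ≥ 1` at the two centre triples. -/
theorem one_le_f3_cY : 1 ≤ f3 cY := by
  rw [f3, blob_self]; linarith [blob_nonneg cX cY]

theorem one_le_f3_cX : 1 ≤ f3 cX := by
  rw [f3, blob_self]; linarith [blob_nonneg cY cX]

/-- The complexified test function as a bare function. -/
def F3fun (u : Fin 3 → E4) : ℂ := (f3 u : ℂ)

theorem F3fun_hasCompactSupport : HasCompactSupport F3fun := by
  refine HasCompactSupport.intro ((isCompact_box cY).union (isCompact_box cX)) fun u hu => ?_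
  simp only [Set.mem_union, not_or] at hu
  have hY : blob cY u = 0 := by
    by_contra h
    exact hu.1 (blob_box h)
  have hX : blob cX u = 0 := by
    by_contra h
    exact hu.2 (blob_box h)
  simp [F3fun, f3, hY, hX]

theorem F3fun_contDiff : ContDiff ℝ (⊤ : ℕ∞) F3fun :=
  (Complex.ofRealCLM.contDiff.of_le le_top).comp ((blob_contDiff cY).add (blob_contDiff cX))

/-- **The test function** `F₃ ∈ 𝓢((ℝ⁴)³)`. -/
def F3 : SchwartzMap (Fin 3 → E4) ℂ := F3fun_hasCompactSupport.toSchwartzMap F3fun_contDiff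

theorem F3_apply (u : Fin 3 → E4) : F3 u = (f3 u : ℂ) := rfl

theorem tsupport_F3 : tsupport (F3 : (Fin 3 → E4) → ℂ) ⊆ box cY ∪ box cX := by
  refine closure_minimal (fun u hu => ?_) ((isClosed_box _).union (isClosed_box _))
  have hu' : f3 u ≠ 0 := by simpa [F3_apply] using hu
  rcases f3_ne_zero hu' with h | h
  · exact Or.inl (blob_box h)
  · exact Or.inr (blob_box h)

/-- Time coordinates of the centres. -/
theorem cY_time : cY 0 0 = 10 ∧ cY 1 0 = 50 ∧ cY 2 0 = 60 := by
  refine ⟨?_, ?_, ?_⟩ <;> simp [cY]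
theorem cX_time : cX 0 0 = 10 ∧ cX 1 0 = 30 ∧ cX 2 0 = 40 := by
  refine ⟨?_, ?_, ?_⟩ <;> simp [cX]
theorem cY_one : cY 0 1 = 50 ∧ cY 1 1 = 10 ∧ cY 2 1 = 10 := by
  refine ⟨?_, ?_, ?_⟩ <;> simp [cY]
theorem cX_one : cX 0 1 = 20 ∧ cX 1 1 = 20 ∧ cX 2 1 = 30 := by
  refine ⟨?_, ?_, ?_⟩ <;> simp [cX]

/-- In a box about centres with increasing, positive times (gaps `> 2`), times are positive and increasing. -/
theorem ordered_of_box {c : Fin 3 → E4} {u : Fin 3 → E4} (hu : u ∈ box c)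
    (h0 : 1 < c 0 0) (h01 : c 0 0 + 2 < c 1 0) (h12 : c 1 0 + 2 < c 2 0) :
    (∀ i, 0 < u i 0) ∧ StrictMono fun i => u i 0 := by
  have hb : ∀ i, u i ∈ Metric.closedBall (c i) 1 := fun i => hu i (Set.mem_univ _)
  have e0 := coord_of_mem_closedBall (hb 0) 0
  have e1 := coord_of_mem_closedBall (hb 1) 0
  have e2 := coord_of_mem_closedBall (hb 2) 0
  refine ⟨fun i => ?_, Fin.strictMono_iff_lt_succ.2 fun i => ?_⟩
  · fin_cases i
    · show 0 < u 0 0; linarith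
    · show 0 < u 1 0; linarith
    · show 0 < u 2 0; linarith
  · fin_cases i
    · show u 0 0 < u 1 0; linarith
    · show u 1 0 < u 2 0; linarith

/-- `F₃` is time-ordered in the `e₀`-frame. -/
theorem F3_isTimeOrdered : IsTimeOrdered F3 := by
  intro u hu
  obtain ⟨hY0, hY1, hY2⟩ := cY_time
  obtain ⟨hX0, hX1, hX2⟩ := cX_time
  rcases tsupport_F3 hu with h | h
  · exact ordered_of_box h (by rw [hY0]; norm_num) (by rw [hY0, hY1]; norm_num) (by rw [hY1, hY2]; norm_num)
  · exact ordered_of_box h (by rw [hX0]; norm_num) (by rw [hX0, hX1]; norm_num) (by rw [hX1, hX2]; norm_num)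

/-- In the unit ball about a centre with coordinates `0, 1` larger than `1`, both coordinates are positive. -/
theorem quadrant_of_ball {v c : E4} (h : v ∈ Metric.ball c 1) (h0 : 1 < c 0) (h1 : 1 < c 1) :
    0 < v 0 ∧ 0 < v 1 := by
  have hb := Metric.ball_subset_closedBall h
  have e0 := coord_of_mem_closedBall hb 0
  have e1 := coord_of_mem_closedBall hb 1
  constructor <;> linarith

/-- Both planar coordinates of every centre exceed `1`. -/
theorem one_lt_cY (i : Fin 3) : 1 < cY i 0 ∧ 1 < cY i 1 := by
  fin_cases i <;> simp [cY]

theorem one_lt_cX (i : Fin 3) : 1 < cX i 0 ∧ 1 < cX i 1 := by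
  fin_cases i <;> simp [cX]

/-- `F₃` is supported in the quadrant `{x₀ > 0, x₁ > 0}³`. -/
theorem F3_quadrant : IsQuadrantSupported F3 := by
  intro u hu i
  have hu' : f3 u ≠ 0 := by simpa [F3_apply] using hu
  rcases f3_ne_zero hu' with h | h
  · exact quadrant_of_ball (blob_ball h i) (one_lt_cY i).1 (one_lt_cY i).2
  · exact quadrant_of_ball (blob_ball h i) (one_lt_cX i).1 (one_lt_cX i).2

/-! ## §5 The quarter-turn form on `F₃` is negative -/

/-- The OS tensor `H₃₃ = θ(R_q F₃)* ⊗ F₃`. -/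
def H33 : SchwartzMap (Fin (3 + 3) → E4) ℂ := SchwartzMap.appendTensor (osAdjoint (linActMulti Rq F3)) F3

theorem H33_isAppend : IsAppendTensorOf H33 (osAdjoint (linActMulti Rq F3)) F3 :=
  isAppendTensorOf_appendTensor _ _

/-- The real integrand behind `H₃₃`. -/
def rfun (w : Fin (3 + 3) → E4) : ℝ :=
  f3 (fun i => Rq.symm (timeReflection 4 (w (Fin.castAdd 3 (Fin.rev i))))) * f3 (fun i => w (Fin.natAdd 3 i))

theorem rfun_nonneg (w : Fin (3 + 3) → E4) : 0 ≤ rfun w := mul_nonneg (f3_nonneg _) (f3_nonneg _)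

/-- Values of `H₃₃` are the real numbers `rfun`. -/
theorem H33_apply (w : Fin (3 + 3) → E4) : H33 w = (rfun w : ℂ) := by
  rw [H33, SchwartzMap.appendTensor_apply, osAdjoint_apply, linActMulti_apply]
  simp only [Function.comp_def, F3_apply, Complex.conj_ofReal, rfun, Complex.ofReal_mul]

/-- The reflected first half of `Z` is the triple `Y` … -/
theorem Z_back : (fun i : Fin 3 => Rq.symm (timeReflection 4 (Z (Fin.castAdd 3 (Fin.rev i))))) = cY := by
  funext i
  fin_cases i
  · show Rq.symm (timeReflection 4 (pt (-50) (-10))) = pt 10 50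
    rw [Rq_symm_theta_pt]; norm_num
  · show Rq.symm (timeReflection 4 (pt (-10) (-50))) = pt 50 10
    rw [Rq_symm_theta_pt]; norm_num
  · show Rq.symm (timeReflection 4 (pt (-10) (-60))) = pt 60 10
    rw [Rq_symm_theta_pt]; norm_num

/-- … and its second half is the triple `X`. -/
theorem Z_front : (fun i : Fin 3 => Z (Fin.natAdd 3 i)) = cX := by
  funext i
  fin_cases i <;> rfl

/-- `rfun (Z) ≥ 1 > 0`. -/
theorem rfun_Z_pos : 0 < rfun Z := by
  unfold rfun
  rw [Z_back, Z_front]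
  exact mul_pos (lt_of_lt_of_le one_pos one_le_f3_cY) (lt_of_lt_of_le one_pos one_le_f3_cX)

theorem f3_continuous : Continuous f3 := ((blob_contDiff cY).add (blob_contDiff cX)).continuous

/-- Continuity of the identity-term integrand. -/
theorem rfun_gZ_continuous : Continuous fun a : E4 => rfun (fun i => Z i + a) := by
  unfold rfun
  refine Continuous.mul (f3_continuous.comp ?_) (f3_continuous.comp ?_)
  · exact continuous_pi fun i =>
      Rq.symm.continuous.comp ((timeReflection 4).continuous.comp (continuous_const.add continuous_id))
  · exact continuous_pi fun i => continuous_const.add continuous_id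

/-- Integrability of the identity-term integrand (it is the modulus of a Schwartz function of `a`). -/
theorem rfun_gZ_integrable : Integrable (fun a : E4 => rfun (fun i => Z i + a)) := by
  have h1 : Integrable (⇑(SchwartzMap.compCLM ℂ (g := gZ) gZ_hasTemperateGrowth gZ_upper H33))
      (volume : Measure E4) := SchwartzMap.integrable _
  refine (h1.norm).mono' rfun_gZ_continuous.aestronglyMeasurable (ae_of_all _ fun a => ?_)
  rw [SchwartzMap.compCLM_apply]
  simp only [Function.comp_apply, Real.norm_eq_abs, abs_of_nonneg (rfun_nonneg _)]
  rw [show gZ a = fun i => Z i + a from rfl, H33_apply, Complex.norm_real, Real.norm_eq_abs,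
    abs_of_nonneg (rfun_nonneg _)]

/-- The identity term of `T H₃₃` is a positive real number. -/
theorem identity_term_pos : 0 < ∫ a : E4, rfun (fun i => Z i + a) := by
  rw [integral_pos_iff_support_of_nonneg (fun a => rfun_nonneg _) rfun_gZ_integrable]
  have hopen : IsOpen (Function.support fun a : E4 => rfun (fun i => Z i + a)) := by
    have : Function.support (fun a : E4 => rfun (fun i => Z i + a)) =
        (fun a : E4 => rfun (fun i => Z i + a)) ⁻¹' {0}ᶜ := by
      ext a; simp
    rw [this]
    exact isOpen_compl_singleton.preimage rfun_gZ_continuous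
  refine hopen.measure_pos volume ⟨0, ?_⟩
  simp only [Function.mem_support, add_zero]
  exact rfun_Z_pos.ne'

/-- Real part of `T H₃₃` as a double sum of real integrals. -/
theorem T_H33_re : (T H33).re = ∑ g : WIdx, ∑ π : Equiv.Perm (Fin 6),
    ∫ a : E4, rfun (fun i => sp g.1 g.2 (Z (π i) + a)) := by
  rw [T_apply, Complex.re_sum]
  refine Finset.sum_congr rfl fun g _ => ?_
  rw [Complex.re_sum]
  refine Finset.sum_congr rfl fun π _ => ?_
  simp only [H33_apply]
  rw [integral_complex_ofReal, Complex.ofReal_re]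

/-- `Re T H₃₃ > 0`: all terms are non-negative and the identity term is positive. -/
theorem T_H33_re_pos : 0 < (T H33).re := by
  rw [T_H33_re]
  have hnn : ∀ (g : WIdx) (π : Equiv.Perm (Fin 6)),
      0 ≤ ∫ a : E4, rfun (fun i => sp g.1 g.2 (Z (π i) + a)) :=
    fun g π => integral_nonneg fun a => rfun_nonneg _
  refine Finset.sum_pos' (fun g _ => Finset.sum_nonneg fun π _ => hnn g π)
    ⟨((1 : Equiv.Perm (Fin 4)), fun _ => false), Finset.mem_univ _, ?_⟩
  refine Finset.sum_pos' (fun π _ => hnn _ π) ⟨1, Finset.mem_univ _, ?_⟩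
  have : (fun a : E4 => rfun (fun i => sp (1 : Equiv.Perm (Fin 4)) (fun _ => false)
      (Z ((1 : Equiv.Perm (Fin 6)) i) + a))) = fun a => rfun (fun i => Z i + a) := by
    funext a
    simp only [sp_one_false, Equiv.Perm.coe_one, id_eq]
  rw [this]
  exact identity_term_pos

/-! ## §6 The refutation -/

/-- The conclusion of `QuarterTurnPositive` for a given family (verbatim tail of the Sketch statement, named so
that the instantiation below compares syntactically identical elaborations). -/
def QTForm (S : SchwingerFamily E4) : Prop :=
  ∀ (Rq : E4 ≃ₗᵢ[ℝ] E4), IsQuarterTurn Rq →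
    ∀ (N : ℕ) (deg : Fin N → ℕ) (F : (j : Fin N) → SchwartzMap (Fin (deg j) → E4) ℂ)
      (c : Fin N → ℂ),
      (∀ j, IsTimeOrdered (F j)) → (∀ j, IsQuadrantSupported (F j)) →
      ∀ H : (i j : Fin N) → SchwartzMap (Fin (deg i + deg j) → E4) ℂ,
        (∀ i j, IsAppendTensorOf (H i j) (osAdjoint (linActMulti Rq (F i))) (F j)) →
        let z := ∑ i, ∑ j, (starRingEnd ℂ) (c i) * c j * S (deg i + deg j) (H i j)
        0 ≤ z.re ∧ z.im = 0

/-- `QuarterTurnPositive` hands the quarter-turn form of the witness family. -/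
theorem qtForm_S6 (h : QuarterTurnPositive) : QTForm S6 := by
  have hsymm : S6.toLabelled.IsSymmetric := fun n _ π F _ => S6_permTest n π F
  have htrans : ∀ (n : ℕ) (a : E4) (F : SchwartzMap (Fin n → E4) ℂ), IsOffDiagonal F →
      S6 n (translateMulti a F) = S6 n F := fun n a F _ => S6_translate n a F
  exact h S6 hsymm htrans S6_eightFrameRP

/-- **Specialisation of the form at `N = 1`, degree `3`** — stated over VARIABLES only, so that the
dependent binders `deg, F, H` are instantiated in a context where nothing heavy can be unfolded. -/
theorem qtForm_one {S : SchwingerFamily E4} (hq : QTForm S) {R : E4 ≃ₗᵢ[ℝ] E4} (hR : IsQuarterTurn R)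
    (F : SchwartzMap (Fin 3 → E4) ℂ) (hF : IsTimeOrdered F) (hQ : IsQuadrantSupported F)
    (H : SchwartzMap (Fin (3 + 3) → E4) ℂ) (hH : IsAppendTensorOf H (osAdjoint (linActMulti R F)) F) :
    0 ≤ (S (3 + 3) H).re := by
  obtain ⟨hre, -⟩ := hq R hR 1 (fun _ => 3) (fun _ => F) (fun _ => 1) (fun _ => hF) (fun _ => hQ)
    (fun _ _ => H) (fun _ _ => hH)
  rw [Fin.sum_univ_one, Fin.sum_univ_one, map_one, one_mul, one_mul] at hre
  exact hre

/-- Degree `3 + 3` of the witness family (syntactic form produced by `qtForm_one`). -/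
theorem S6_33 : S6 (3 + 3) = -T := rfl

/-- **The witness family violates the quarter-turn form.** -/
theorem not_qtForm_S6 : ¬ QTForm S6 := by
  intro hq
  have h := qtForm_one hq isQuarterTurn_Rq F3 F3_isTimeOrdered F3_quadrant H33 H33_isAppend
  rw [S6_33, neg_clm_apply, Complex.neg_re] at h
  linarith [T_H33_re_pos]

/-- **Theorem (crux-triage r1/3, gen 2).** The first lemma `QuarterTurnPositive` of card `quarter-turn-root`
is false: the family `𝔖₆ = -T` is symmetric, translation invariant and reflection positive in all eight
planar frames, `F₃` is `e₀`-time-ordered and quadrant-supported, and the quarter-turn form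
`𝔖₆(θ(R_q F₃)* ⊗ F₃) = -T(H₃₃)` has negative real part. -/
theorem not_QuarterTurnPositive : ¬ QuarterTurnPositive := fun h => not_qtForm_S6 (qtForm_S6 h)

end Summit.QuantumFields.YangMills.Cruxes.NPointIsotropy.Triage3g2

end
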